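import Literature.NumberTheory.EllipticCurves.ZpExtension
import Mathlib.Topology.Algebra.OpenSubgroup
import HarnessLib

/-!
# The prime-to-`p` exponent: the image of `ker κ ∩ D_v` in the finite quotients `D_v/(U·I_v)` has
# order prime to `p` (group theory behind GV's "`G_η/I_η` has profinite order prime to `p`")

HONEST FRAMING (cell `b2b-bsdres`, run/shared/lean/b2b/bsd-rank1-residual/, verbatim in every
file): the goal of the cell is to DELETE the COMBINATION-SHAPED residual classes of the
Birch–Swinnerton-Dyer formula for ALL analytic-rank `≤ 1` elliptic curves over `ℚ` — "full BSD
formula for every rank `≤ 1` curve in class `C`" assembled STRICTLY from published theorems — so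
that the rank-`≤ 1` remainder becomes exactly the CONSTRUCTION-SHAPED classes, which are TYPED
(missing-input `Prop`s), NOT attempted. This is not "finishing BSD". Sub-cell
`b2b-bsdres-eisenstein-p2` (CLASS-OWNERS row "X2"), gen 10: research route; NO CLAIM BEYOND STATED
CLASSES; nothing here changes a label. THEOREMS ONLY (no `def`, no named fact, nothing asserted).

WHY. Greenberg–Vatsal (Invent. Math. 142 (2000), §2 p. 17) define the local condition of their
Selmer groups over `ℚ_∞` at `η ∤ p` by restriction to the INERTIA group, remarking: "`G_η/I_η` has
profinite order prime to `p`. So the last condition is equivalent to `[σ|_{I_η}] = 0`" — i.e. over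
the cyclotomic tower "unramified at `η`" and "trivial at `η`" coincide for `p`-primary coefficients.
The tree's two Selmer vocabularies differ exactly here (`GreenbergVatsalTorsion.unramKer`, inertia,
vs `GreenbergSelmer.awayKer` / `WeierstrassCurve.localKerOver`, decomposition group), and the
referee's nit `gvSelmer-SelmerDualData-link` (R102.2 (b), R106.8: equality half) asks for the
identification. This file is the pure GROUP THEORY of the remark (no number fields): sibling files
`GreenbergVatsalProPrimeToPCocycle` (the cohomological consequence) and
`GreenbergVatsalUnramifiedAway` (the number-field instantiation) consume it.

SET-UP ("Frobenius set-up", hypotheses of `exists_coprime_pow_mem_modSubgroup`). `Γ` a compact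
topological group, `I ≤ G ≤ Γ` with `I` normalised by `G` (inertia ⊴ decomposition), `φ ∈ G` such
that every `d ∈ G` is `φⁿ · i · u` with `i ∈ I` and `u` in any prescribed open subgroup `U`
(Frobenius and inertia generate `G` modulo open subgroups — for `Γ = Γ_K` this is the tree's
`FrobeniusGeneration.exists_eq_frobenius_pow_mul_of_mem_decompositionSubgroup`), and a homomorphism
`κ : Γ → ℤ_p` (a `ℤ_p`-extension) with `κ(I) = 1` ("unramified"), `κ φ ≠ 1` ("not split") and
`κ ≡ 0 (mod p^B)` on some open subgroup for every `B` (continuity).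

RESULT (`exists_coprime_pow_mem_modSubgroup`). For every open normal `U ⊴ Γ` there is `m' ≥ 1`
PRIME TO `p` with `x^{m'} ∈ N_U := (U·I) ∩ G` for all `x ∈ ker κ ∩ G`. Proof: `G/N_U` is finite
cyclic generated by `φ̄` of order `m = p^e m'`; for `x ∈ ker κ ∩ G` write `x = φ^j i u` with `u` so
deep that `p^{v(κφ)+e} ∣ κ(u)`; then `κ(x) = 1` gives `p^{v(κφ)+e} ∣ j·κ(φ)`, so `p^e ∣ j`, and
`x̄^{m'} = φ̄^{jm'} = 1`.

References: Greenberg–Vatsal (2000) §2 p. 17; Neukirch, *ANT*, I (9.4)–(9.6); Washington,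
*Cyclotomic Fields*, §13.1.
-/

noncomputable section

open scoped Classical Pointwise

universe u

namespace Summit.BirchSwinnertonDyer.Rank1Residual.X2.GreenbergVatsalProPrimeToP

/-! ## §1. Group theory: the subgroup `(U·I) ∩ G` -/

section GroupTheory

variable {Γ : Type u} [Group Γ]

/-- Powers of `a * n` modulo a subgroup `N` normalised by `G ∋ a`: `(a n)^k = a^k n'` with
`n' ∈ N`. [folklore] -/
theorem exists_mul_pow_eq {G N : Subgroup Γ} (hN : ∀ g ∈ G, ∀ n ∈ N, g * n * g⁻¹ ∈ N)
    {a n : Γ} (ha : a ∈ G) (hn : n ∈ N) (k : ℕ) : ∃ n' ∈ N, (a * n) ^ k = a ^ k * n' := by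
  induction k with
  | zero => exact ⟨1, N.one_mem, by simp⟩
  | succ k ih =>
    obtain ⟨n', hn', hk⟩ := ih
    refine ⟨a⁻¹ * n' * a * n, N.mul_mem ?_ hn, ?_⟩
    · have := hN a⁻¹ (G.inv_mem ha) n' hn'
      rwa [inv_inv] at this
    · rw [pow_succ, hk, pow_succ]; group

/-- Membership in `U ⊔ I` for `U` normal: `x = u * i`. [folklore] -/
theorem mem_sup_iff_of_normal (U I : Subgroup Γ) [U.Normal] (x : Γ) :
    x ∈ U ⊔ I ↔ ∃ u ∈ U, ∃ i ∈ I, u * i = x := by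
  rw [← SetLike.mem_coe, Subgroup.normal_mul, Set.mem_mul]
  simp only [SetLike.mem_coe]

variable {G I : Subgroup Γ} {U : Subgroup Γ} [U.Normal]

/-- Membership in `N_U = (U·I) ∩ G` (the elements of `G` that are inertial modulo the open normal
subgroup `U`). [folklore] -/
theorem mem_modSubgroup_iff (x : Γ) :
    x ∈ (U ⊔ I) ⊓ G ↔ (∃ u ∈ U, ∃ i ∈ I, u * i = x) ∧ x ∈ G := by
  rw [Subgroup.mem_inf, mem_sup_iff_of_normal]

/-- `I ≤ N_U` when `I ≤ G`. [folklore] -/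
theorem le_modSubgroup (hIG : I ≤ G) : I ≤ (U ⊔ I) ⊓ G :=
  fun i hi ↦ (mem_modSubgroup_iff i).2 ⟨⟨1, U.one_mem, i, hi, one_mul i⟩, hIG hi⟩

/-- `U ⊓ G ≤ N_U`. [folklore] -/
theorem mem_modSubgroup_of_mem {x : Γ} (hxU : x ∈ U) (hxG : x ∈ G) : x ∈ (U ⊔ I) ⊓ G :=
  (mem_modSubgroup_iff x).2 ⟨⟨x, hxU, 1, I.one_mem, mul_one x⟩, hxG⟩

/-- `N_U` is normalised by `G` when `I` is (`I ⊴ G`). [folklore] -/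
theorem conj_mem_modSubgroup (hI : ∀ g ∈ G, ∀ i ∈ I, g * i * g⁻¹ ∈ I) {g x : Γ} (hg : g ∈ G)
    (hx : x ∈ (U ⊔ I) ⊓ G) : g * x * g⁻¹ ∈ (U ⊔ I) ⊓ G := by
  obtain ⟨⟨u, hu, i, hi, rfl⟩, hxG⟩ := (mem_modSubgroup_iff x).1 hx
  refine (mem_modSubgroup_iff _).2 ⟨⟨g * u * g⁻¹, ?_, g * i * g⁻¹, hI g hg i hi, by group⟩,
    G.mul_mem (G.mul_mem hg hxG) (G.inv_mem hg)⟩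
  exact Subgroup.Normal.conj_mem inferInstance u hu g

/-- `N_U`, viewed inside `G`, is a normal subgroup of `G` (when `I ⊴ G`). [folklore] -/
theorem modSubgroup_subgroupOf_normal (hI : ∀ g ∈ G, ∀ i ∈ I, g * i * g⁻¹ ∈ I) :
    (((U ⊔ I) ⊓ G).subgroupOf G).Normal := by
  refine ⟨fun n hn g ↦ ?_⟩
  rw [Subgroup.mem_subgroupOf] at hn ⊢
  simp only [Subgroup.coe_mul, Subgroup.coe_inv]
  exact conj_mem_modSubgroup hI g.2 hn

end GroupTheory

/-! ## §2. The prime-to-`p` exponent: `x^{m'} ∈ N_U` for every `x ∈ ker κ ∩ G` -/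

section Exponent

variable {Γ : Type u} [Group Γ] [TopologicalSpace Γ] [IsTopologicalGroup Γ] [CompactSpace Γ]
variable {p : ℕ} [Fact p.Prime]

omit [Fact p.Prime] in
/-- `p`-adic bookkeeping: if `p^{v(a)+e} ∣ j·a` in `ℤ_p` with `a ≠ 0`, then `p^e ∣ j`. [folklore] -/
theorem pow_dvd_of_pow_valuation_add_dvd [Fact p.Prime] {a : ℤ_[p]} (ha : a ≠ 0) {e j : ℕ}
    (h : (p : ℤ_[p]) ^ (a.valuation + e) ∣ (j : ℤ_[p]) * a) : p ^ e ∣ j := by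
  set t := a.valuation with ht
  have hp0 : (p : ℤ_[p]) ^ t ≠ 0 := pow_ne_zero _ (NeZero.ne _)
  have hdec : a = (PadicInt.unitCoeff ha : ℤ_[p]) * (p : ℤ_[p]) ^ t := PadicInt.unitCoeff_spec ha
  rw [hdec, pow_add, ← mul_assoc, mul_comm ((p : ℤ_[p]) ^ t), mul_dvd_mul_iff_right hp0,
    Units.dvd_mul_right] at h
  have h' : (p : ℤ_[p]) ^ e ∣ ((j : ℤ) : ℤ_[p]) := by rwa [Int.cast_natCast]
  rw [PadicInt.pow_p_dvd_int_iff] at h'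
  exact_mod_cast h'

variable {G I : Subgroup Γ} {φ : Γ} {κ : Γ →* Multiplicative ℤ_[p]}

/-- **The prime-to-`p` exponent lemma.** Hypotheses ("Frobenius set-up"): `I ≤ G`, `I`
normalised by `G`, `φ ∈ G`, every element of `G` is `φⁿ · i · u` with `i ∈ I` and `u` in any
prescribed open subgroup (Frobenius and inertia generate the decomposition group modulo open
subgroups), `κ : Γ → ℤ_p` kills `I` ("unramified in `K_∞/K`"), `κ φ ≠ 1` ("does not split
completely"), and `κ` is divisible by `p^B` on some open subgroup, for every `B` (continuity).
Conclusion: for every open normal subgroup `U ⊴ Γ` there is `m' ≥ 1` PRIME TO `p` with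
`x^{m'} ∈ N_U = (U·I) ∩ G` for every `x ∈ ker κ ∩ G` — the image of `ker κ ∩ G` in the finite
cyclic group `G/N_U = ⟨φ̄⟩` lies in its prime-to-`p` part, because `x ≡ φ^j (mod N_U)` with
`κ(φ)^j ∈ κ(U') ⊆ p^B ℤ_p` for arbitrarily deep `U'` forces `p^e ∣ j`, `p^e ∥ ord φ̄`. This is
the group theory behind GV's "`G_η/I_η` has profinite order prime to `p`" (`ℚ_{∞,η}`, `η ∤ p`).
[cite: GreenbergVatsal2000, §2 p. 17] -/
theorem exists_coprime_pow_mem_modSubgroup (hIG : I ≤ G)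
    (hIn : ∀ g ∈ G, ∀ i ∈ I, g * i * g⁻¹ ∈ I) (hφ : φ ∈ G)
    (hdec : ∀ U : Subgroup Γ, IsOpen (U : Set Γ) → ∀ d ∈ G,
      ∃ (n : ℕ) (i u : Γ), i ∈ I ∧ u ∈ U ∧ d = φ ^ n * i * u)
    (hκI : ∀ i ∈ I, κ i = 1) (hκφ : κ φ ≠ 1)
    (hlayer : ∀ B : ℕ, ∃ V : Subgroup Γ, IsOpen (V : Set Γ) ∧
      ∀ v ∈ V, (p : ℤ_[p]) ^ B ∣ (κ v).toAdd)
    (U : Subgroup Γ) [U.Normal] (hU : IsOpen (U : Set Γ)) :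
    ∃ m' : ℕ, 0 < m' ∧ Nat.Coprime m' p ∧
      ∀ x ∈ G, κ x = 1 → x ^ m' ∈ (U ⊔ I) ⊓ G := by
  -- the finite cyclic quotient `G / N_U`
  haveI hNn : (((U ⊔ I) ⊓ G).subgroupOf G).Normal := modSubgroup_subgroupOf_normal hIn
  set Q := G ⧸ ((U ⊔ I) ⊓ G).subgroupOf G with hQ
  set φ' : G := ⟨φ, hφ⟩ with hφ'
  set φb : Q := QuotientGroup.mk φ' with hφb
  haveI : Finite (Γ ⧸ U) := Subgroup.quotient_finite_of_isOpen _ hU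
  haveI : U.FiniteIndex := Subgroup.finiteIndex_of_finite_quotient
  have hidx : U.index ≠ 0 := Subgroup.FiniteIndex.index_ne_zero
  have hmemQ : ∀ (y : G), (QuotientGroup.mk y : Q) = 1 ↔ (y : Γ) ∈ (U ⊔ I) ⊓ G := by
    intro y
    rw [QuotientGroup.eq_one_iff, Subgroup.mem_subgroupOf]
  have hfin : IsOfFinOrder φb := by
    rw [isOfFinOrder_iff_pow_eq_one]
    refine ⟨U.index, Nat.pos_of_ne_zero hidx, ?_⟩
    rw [hφb, ← QuotientGroup.mk_pow, hmemQ]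
    exact mem_modSubgroup_of_mem (U.pow_index_mem φ) (G.pow_mem hφ _)
  set m := orderOf φb with hm
  have hm0 : m ≠ 0 := (orderOf_pos_iff.2 hfin).ne'
  obtain ⟨e, m', hm', hme⟩ := Nat.exists_eq_pow_mul_and_not_dvd hm0 p (Fact.out : p.Prime).ne_one
  have hm'0 : 0 < m' := by
    refine Nat.pos_of_ne_zero ?_
    rintro rfl
    rw [mul_zero] at hme
    exact hm0 hme
  refine ⟨m', hm'0, ((Nat.Prime.coprime_iff_not_dvd Fact.out).2 hm').symm, fun x hxG hκx ↦ ?_⟩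
  -- decompose `x` with respect to the deep open subgroup `U ∩ V`, `κ(V) ⊆ p^{v(a)+e} ℤ_p`
  set a : ℤ_[p] := (κ φ).toAdd with ha
  have ha0 : a ≠ 0 := fun h ↦ hκφ (by
    apply Multiplicative.toAdd.injective; rw [← ha, h, toAdd_one])
  obtain ⟨V, hV, hVB⟩ := hlayer (a.valuation + e)
  obtain ⟨j, i, u, hi, hu, hx⟩ := hdec (U ⊓ V) (hU.inter hV) x hxG
  obtain ⟨huU, huV⟩ := Subgroup.mem_inf.1 hu
  -- `κ`: `j • a = -(κ u)` is divisible by `p^{v(a)+e}`, so `p^e ∣ j`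
  have hκ : (j : ℤ_[p]) * a = -(κ u).toAdd := by
    have h1 : κ x = κ φ ^ j * κ i * κ u := by rw [hx, map_mul, map_mul, map_pow]
    rw [hκx, hκI i hi, mul_one] at h1
    have h2 := congrArg Multiplicative.toAdd h1
    rw [toAdd_one, toAdd_mul, toAdd_pow, ← ha, nsmul_eq_mul] at h2
    linear_combination -h2
  have hej : p ^ e ∣ j := by
    refine pow_dvd_of_pow_valuation_add_dvd ha0 ?_
    rw [hκ]
    exact (hVB u huV).neg_right
  -- in `Q`: `x̄ = φ̄^j`, hence `x̄^{m'} = φ̄^{j m'} = 1`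
  have hiG : i ∈ G := hIG hi
  have huG : u ∈ G := by
    have : u = (φ ^ j * i)⁻¹ * x := by rw [hx]; group
    rw [this]
    exact G.mul_mem (G.inv_mem (G.mul_mem (G.pow_mem hφ _) hiG)) hxG
  have hiu : i * u ∈ (U ⊔ I) ⊓ G := by
    refine (mem_modSubgroup_iff _).2 ⟨⟨i * u * i⁻¹, ?_, i, hi, by group⟩, G.mul_mem hiG huG⟩
    exact Subgroup.Normal.conj_mem inferInstance u huU i
  have hxQ : (QuotientGroup.mk (⟨x, hxG⟩ : G) : Q) = φb ^ j := by
    have hx' : (⟨x, hxG⟩ : G) = φ' ^ j * ⟨i * u, G.mul_mem hiG huG⟩ := by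
      apply Subtype.ext
      simp only [Subgroup.coe_mul, SubgroupClass.coe_pow, hφ']
      rw [hx, mul_assoc]
    rw [hx', QuotientGroup.mk_mul, QuotientGroup.mk_pow, (hmemQ ⟨i * u, _⟩).2 hiu, mul_one]
  have hpow : φb ^ (j * m') = 1 := by
    rw [← orderOf_dvd_iff_pow_eq_one, ← hm, hme]
    exact mul_dvd_mul hej (dvd_refl m')
  have h := (hmemQ ((⟨x, hxG⟩ : G) ^ m')).1 (by rw [QuotientGroup.mk_pow, hxQ, ← pow_mul, hpow])
  simpa only [SubgroupClass.coe_pow] using h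

end Exponent

end Summit.BirchSwinnertonDyer.Rank1Residual.X2.GreenbergVatsalProPrimeToP

end
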